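/-
Copyright (c) 2026 the pub-hodgecm-mathlib formalisation cell (harness21).  Prover seat hodgecm-mathlib-LA1-p04 (g3), «GO 500» half A, line L1 hand on the L3 ROOF road
(socket `stub_FROB` → `stub_ROOF0`), organ **(ν8k-b)** «THE KERNEL BOUND DOWNSTAIRS», generic half (LA3-plan (g2) deal (hker-DOWN) 2026-09-02T06:15:00Z (2)); 2026-09-02.
-/
import Literature.AlgebraicGeometry.AbelianSchemes.AbelianSchemeHomReductionSpecialFibreComp
import Literature.AlgebraicGeometry.AbelianSchemes.IsogenyKernelReduction
import Literature.AlgebraicGeometry.AbelianSchemes.KernelClauseSpecialOfGeneric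
import HarnessLib

/-!
# REDUCTION OF A HOMOMORPHISM BETWEEN FIBRE TUPLES — A ONE-SIDED KERNEL BOUND `Ker u ⊆ 𝒜_x[𝔞]` PASSES TO THE SPECIAL FIBRE `Ker ū ⊆ 𝒜_{x̄}[𝔞]`
# ([SerreTate1968] §1 Lemma 2; [BoschLutkebohmertRaynaud1990] §7.1 Lemma 5, §7.3 Prop. 6; [EGAIV3] 11.10.5)

Topic `AlgebraicGeometry/AbelianSchemes`, namespace `Literature.AlgebraicGeometry.AbelianSchemes.AbelianSchemeOver`.  THEOREMS ONLY (no definition, no named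
fact, no `instance`, no notation, no `sorry`).  Cell `hodgecm-mathlib` (D-0151), F0∕P6 «MOD», «GO 500» half A line L3 (socket `stub_FROB` of the D-line
`Cruxes/HLiu418/Lines/F0_P6a_DatumOfInputs.lean`, road ROOF → `stub_ROOF0`), organ **(ν8k-b)** = the ONE-SIDED sibling of ★ (ν8k) `AbelianSchemeHomReductionSpecialFibreKernel`
(there: `Ker u = 𝒜_x[𝔞]` ⇒ `Ker ū = 𝒜_{x̄}[𝔞]`, two-sided, `𝔞` Serre-presented).  HERE: the head of ★ (ν8h) `exists_specialFibre_hom_reduction_comp` VERBATIM — the special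
fibre `ū : (𝒜_s)_{x̄} → (𝒞_s)_{x̄″}` of a homomorphism `u : (𝒜_η)_x → (𝒞_η)_{x″}` with its transfers (i) (ii) (iii) (iv) (iv-h) — PLUS a sixth transfer **(v-b)**: for an
`𝒪`-action `act` on `𝒜` and ANY ideal `𝔞` of `𝒪` (no presentation, no flat layer), if `u` is finite surjective and `Ker u ⊆ 𝒜_x[𝔞]` on ALL `T`-points
(`t ≫ u = 1 → ∀ r ∈ 𝔞, t ≫ ι(r)_x = 1`), then `Ker ū ⊆ 𝒜_{x̄}[𝔞]` on ALL `T`-points — for THE SAME `ū` (the bound leaves the `∃` as a row of the producing head; the rows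
(i)–(iv-h) carry no kernel information and no downstairs uniqueness is exported, so it cannot be bolted on from outside).

WHY (consumer: the L3 ROOF road, LA3-plan (g2) (hker-DOWN); [Liu2021] Prop. D.8 p. 135, pp. 136–138): the reduced roof leg `q̄` of ★ organ #3-bis
`exists_roofLeg_specialFibre_of_downstairsDual` must be known to have `Ker q̄ ⊆ 𝒜_{x̄}[𝔭_w·𝔭_{c•w}]` (no banal component) for the block-law assembly ★
`FrobeniusKernelLawBlockAssembly` (`hker`); upstairs `Ker q = K ⊆ 𝒜_y[𝔭_w·𝔭_{c•w}]` is the support clause of the Hecke translate (`K ≅ H_L ⊕ 𝒜_y[𝔭_w]` is a PROPER subgroup of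
`𝒜_y[𝔭_w·𝔭_{c•w}]`, so the two-sided (v′) of ★ (ν8k) does not apply).  ★ `RoofLegsSpecialFibreKernelBound` re-runs #3-bis on this head.

ROAD (no descent, no degree count, no Serre data).  §1 ONE-SIDED STAGE LEMMA `comp_i_eq_one_special_of_generic`: over a stage `V′` with a schematically dominant
quasi-compact point `a′`, `U` with FLAT kernel and `Ker U_{a′} ⊆ 𝒜′_{a′}[𝔞]` on all `T`-points has `Ker U_{b′} ⊆ 𝒜′_{b′}[𝔞]` on all `T`-points at every `b′`: `ι(r)`
(`r ∈ 𝔞`) kills the flat `Ker U` — an identity of morphisms out of a flat source into the separated `𝒜′`, decided at `a′` (★ `pullback_map_injective_of_flat`) — and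
`(Ker U)_{b′}` carries the kernel clause of `U_{b′}` (★ `exists_comp_map_kerι_iff`, kernels commute with base change).  §2 transports the bound through the generic and
special five-piece along-stage isomorphisms (equivariant by ★ (ν6) §1 `fibreHom_comp_alongStageIso_hom`; one-sided twins of ★ (ν8k) §0).  §3 HEAD: ★ (ν7) turnkey; the six
rows are ★ (ν8) §1 (ii)(iii)(iv), ★ (ν8h) §1 (iv-h) and §2 here; `Ker U → Spec D′` is flat since every fibre of `U` is an isogeny (★ `flat_ker_hom`).

HONEST LABEL: HC_CM is proved only modulo the cell's 2 remaining named inputs (hLiu418 24832, h413 24833) until rung 0 closes; generic capital on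
`--supports stmt-HodgeConjecture-24832`, pays no letter.

## References
* [SerreTate1968] J.-P. Serre, J. Tate, *Good reduction of abelian varieties*, Ann. of Math. 88 (1968), §1 (Lemma 2, Theorem 1).
* [BoschLutkebohmertRaynaud1990] S. Bosch, W. Lütkebohmert, M. Raynaud, *Néron Models* (1990), §1.2 Prop. 8, §7.1 Lemma 5 (p. 176), §7.3 Prop. 6 (p. 180).
* [GortzWedhorn2020] U. Görtz, T. Wedhorn, *Algebraic Geometry I*, 2nd ed. (2020), (4.15) (p. 116), Definition 4.45 (2) (p. 117).
* [MumfordFogartyKirwan1994] D. Mumford, J. Fogarty, F. Kirwan, *GIT*, 3rd ed., Ch. 6 §1 Cor. 6.2 (p. 116), Ch. 7 §2 Def. 7.1–7.2 (p. 129).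
* [MumfordAV1970] D. Mumford, *Abelian Varieties* (1970), §7 Thm. 4 (p. 72), §15 Thm. 1 (p. 143).
* [EGAIV3] A. Grothendieck, J. Dieudonné, EGA IV₃ (1966), 11.10.5.
-/

set_option autoImplicit false

noncomputable section

set_option backward.isDefEq.respectTransparency false

open CategoryTheory CategoryTheory.Limits AlgebraicGeometry MonoidalCategory CartesianMonoidalCategory
open scoped MonObj CategoryTheory.Obj NumberField
open Literature.AlgebraicGeometry.Motives
open IsDedekindDomain IsDedekindDomain.HeightOneSpectrum ValuativeRel
open Literature.NumberTheory.EllipticCurves (genericFibre specGenericPoint)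
open Literature.NumberTheory.GaloisRepresentations (closureValuationSubring)
open Literature.NumberTheory.DiophantineGeometry
open Literature.AlgebraicGeometry.GroupSchemes.GroupSchemeKernel (ker kerι kerLift kerLift_ι kerι_comp)

namespace Literature.AlgebraicGeometry.AbelianSchemes

namespace AbelianSchemeOver

universe u

section Bookkeeping

/-! ### §0 Bookkeeping: one-sided kernel bounds on `T`-points through isomorphisms of abelian varieties -/

variable {k : Type u} [Field k]

/-- Post-composition with an isomorphism of abelian varieties detects the unit: `f ≫ E = 1 ↔ f = 1`. [folklore] -/
private theorem comp_avIso_hom_eq_one_iff_kb {X Y : AbelianVariety k} (E : X ≅ Y) {W : Over (Spec (.of k))} (f : W ⟶ X.X) :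
    f ≫ E.hom.hom.hom.hom = 1 ↔ f = 1 := by
  refine ⟨fun h => ?_, fun h => by rw [h, MonObj.one_comp]⟩
  have h1 := congrArg (fun φ => φ ≫ E.inv.hom.hom.hom) h
  simp only [Category.assoc, AbelianVariety.iso_hom_hom_hom_hom_comp_inv, Category.comp_id, MonObj.one_comp] at h1
  exact h1

/-- **TRANSPORT OF A ONE-SIDED KERNEL BOUND THROUGH A CONJUGATION.**  `E_A : X ≅ P`, `E_C : C ≅ Q` isomorphisms of abelian varieties, `U′ = E_A⁻¹ ≫ u ≫ E_C`,
endomorphism families `F_X`, `F_P` intertwined by `E_A` on `S`; if `Ker u ⊆ ⋂_{r ∈ S} Ker F_X(r)` on all `T`-points then `Ker U′ ⊆ ⋂_{r ∈ S} Ker F_P(r)` on all `T`-points.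
(One-sided twin of ★ (ν8k) §0.) [folklore] -/
private theorem comp_eq_one_of_conj_of_kerBound {X P C Q : AbelianVariety k} (EA : X ≅ P) (EC : C ≅ Q) {uAV : X ⟶ C} {U' : P ⟶ Q}
    (hU : U' = EA.inv ≫ uAV ≫ EC.hom) {σ : Type*} (S : Set σ) (FX : σ → (X ⟶ X)) (FP : σ → (P ⟶ P))
    (hequiv : ∀ r ∈ S, FX r ≫ EA.hom = EA.hom ≫ FP r)
    (hlaw : ∀ ⦃W : Over (Spec (.of k))⦄ (t : W ⟶ X.X), t ≫ uAV.hom.hom.hom = 1 → ∀ r ∈ S, t ≫ (FX r).hom.hom.hom = 1)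
    ⦃W : Over (Spec (.of k))⦄ (t : W ⟶ P.X) : t ≫ U'.hom.hom.hom = 1 → ∀ r ∈ S, t ≫ (FP r).hom.hom.hom = 1 := by
  subst hU
  intro ht r hr
  have e1 : (EA.inv ≫ uAV ≫ EC.hom).hom.hom.hom = EA.inv.hom.hom.hom ≫ uAV.hom.hom.hom ≫ EC.hom.hom.hom.hom := rfl
  rw [e1, ← Category.assoc, ← Category.assoc, comp_avIso_hom_eq_one_iff_kb EC] at ht
  have h0 := hlaw (t ≫ EA.inv.hom.hom.hom) ht r hr
  have h1 := congrArg (fun φ => (EA.inv ≫ φ ≫ EA.inv).hom.hom.hom) (hequiv r hr)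
  simp only [Category.assoc, Iso.hom_inv_id, Category.comp_id, Iso.inv_hom_id_assoc] at h1
  have h2 : EA.inv.hom.hom.hom ≫ (FX r).hom.hom.hom = (FP r).hom.hom.hom ≫ EA.inv.hom.hom.hom := h1
  rw [Category.assoc, h2, ← Category.assoc] at h0
  exact (comp_avIso_hom_eq_one_iff_kb EA.symm (t ≫ (FP r).hom.hom.hom)).1 h0

/-- The same transport for `U″ = E_A ≫ u ≫ E_C⁻¹` with `E_A : P ≅ X`, `E_C : Q ≅ C` and `F_P(r) ≫ E_A = E_A ≫ F_X(r)`. [folklore] -/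
private theorem comp_eq_one_of_conj_of_kerBound' {X P C Q : AbelianVariety k} (EA : P ≅ X) (EC : Q ≅ C) (uAV : X ⟶ C)
    {σ : Type*} (S : Set σ) (FX : σ → (X ⟶ X)) (FP : σ → (P ⟶ P)) (hequiv : ∀ r ∈ S, FP r ≫ EA.hom = EA.hom ≫ FX r)
    (hlaw : ∀ ⦃W : Over (Spec (.of k))⦄ (t : W ⟶ X.X), t ≫ uAV.hom.hom.hom = 1 → ∀ r ∈ S, t ≫ (FX r).hom.hom.hom = 1)
    ⦃W : Over (Spec (.of k))⦄ (t : W ⟶ P.X) : t ≫ (EA.hom ≫ uAV ≫ EC.inv).hom.hom.hom = 1 → ∀ r ∈ S, t ≫ (FP r).hom.hom.hom = 1 :=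
  comp_eq_one_of_conj_of_kerBound EA.symm EC.symm (U' := EA.hom ≫ uAV ≫ EC.inv) rfl S FX FP (fun r hr => by
    have h1 := congrArg (fun φ => EA.inv ≫ φ ≫ EA.inv) (hequiv r hr)
    simp only [Category.assoc, Iso.hom_inv_id, Category.comp_id, Iso.inv_hom_id_assoc] at h1
    exact h1.symm) hlaw t

end Bookkeeping

section Stage

/-! ### §1 The one-sided stage lemma: a kernel bound at the schematically dominant point holds at every point -/

variable {V' : Scheme.{u}} {Ω κ : Type u} [Field Ω] [Field κ] (a' : Spec (.of Ω) ⟶ V') (b' : Spec (.of κ) ⟶ V')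
  [QuasiCompact a'] [IsSchemeTheoreticallyDominant a']
  {𝒜' 𝒞' : AbelianSchemeOver V'} {O : Type*} [CommRing O] (act' : 𝒜'.RingAction O)
  (U : 𝒜'.X ⟶ 𝒞'.X) [Flat (ker U).hom]

/-- **(ν8k-b) ONE-SIDED STAGE LEMMA.**  Over a stage `V′` with a schematically dominant quasi-compact point `a′ : Spec Ω → V′`: if `U : 𝒜′ → 𝒞′` has FLAT kernel and
`Ker U_{a′} ⊆ 𝒜′_{a′}[𝔞]` on all `T`-points (`t ≫ U_{a′} = 1 → ∀ r ∈ 𝔞, t ≫ ι(r)_{a′} = 1`; `𝔞` ANY ideal, no presentation), then `Ker U_{b′} ⊆ 𝒜′_{b′}[𝔞]` on all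
`T`-points at EVERY point `b′` of the stage.  ROAD: for `r ∈ 𝔞`, `kerι U ≫ ι(r) = 1` over `V′` — a morphism out of the FLAT `Ker U` into the separated `𝒜′`, decided after base
change to `a′` (★ `pullback_map_injective_of_flat`; at `a′` the point `(kerι U)_{a′}` is killed by `U_{a′}`); at `b′`, a point killed by `U_{b′}` factors through `(kerι U)_{b′}`
(★ `exists_comp_map_kerι_iff`: kernels commute with base change). [cite: BoschLutkebohmertRaynaud1990, §7.1 Lemma 5 (p. 176) and §7.3 Prop. 6 (p. 180)]
[cite: EGAIV3, 11.10.5] [cite: GortzWedhorn2020, (4.15) (p. 116) and Definition 4.45 (2) (p. 117)] -/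
theorem comp_i_eq_one_special_of_generic (𝔞 : Ideal O)
    (hgen : ∀ ⦃T : Over (Spec (.of Ω))⦄ (t : T ⟶ (𝒜'.baseChange a').X),
      t ≫ baseChangeHom U a' = 1 → ∀ r ∈ 𝔞, t ≫ (act'.baseChange a').i r = 1)
    ⦃T : Over (Spec (.of κ))⦄ (t : T ⟶ (𝒜'.baseChange b').X) :
    t ≫ baseChangeHom U b' = 1 → ∀ r ∈ 𝔞, t ≫ (act'.baseChange b').i r = 1 := by
  haveI := 𝒜'.isProper
  haveI : IsSeparated 𝒜'.X.hom := inferInstance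
  intro ht r hr
  -- (1) `ι(r)` kills the flat `Ker U` over the whole stage (decided at the schematically dominant point `a′`)
  have hk : kerι U ≫ act'.i r = 1 := by
    have key : (Over.pullback a').map (kerι U ≫ act'.i r) = (Over.pullback a').map (1 : ker U ⟶ 𝒜'.X) := by
      rw [Functor.map_comp, pullback_map_one]
      have h1 : (Over.pullback a').map (kerι U) ≫ baseChangeHom U a' = (1 : _ ⟶ (𝒞'.baseChange a').X) := by
        have h0 := congrArg (fun f => (Over.pullback a').map f) (kerι_comp U)
        simp only [Functor.map_comp] at h0
        rw [pullback_map_one] at h0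
        exact h0
      have h2 := hgen ((Over.pullback a').map (kerι U)) h1 r hr
      rw [RingAction.baseChange_i] at h2
      exact h2
    exact Literature.AlgebraicGeometry.Limits.pullback_map_injective_of_flat a' key
  -- (2) at `b′`: a point killed by `U_{b′}` factors through `(Ker U)_{b′}` (kernels commute with base change)
  obtain ⟨s, hs⟩ := (exists_comp_map_kerι_iff b' U t).2 ht
  rw [← hs, RingAction.baseChange_i, Category.assoc, ← Functor.map_comp, hk, pullback_map_one, MonObj.comp_one]

end Stage

section AbstractKerBound

/-! ### §2 The abstract two-stage setting of ★ (ν8) §1: the one-sided kernel bound transfers from `u` to `ū` -/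

variable {T Ug V V' Us : Scheme.{u}} {Ω κ : Type u} [Field Ω] [Field κ]
  (j : Ug ⟶ T) (z z'' : V ⟶ T) (g : V' ⟶ V) (y y'' : Spec (.of Ω) ⟶ Ug) (a : Spec (.of Ω) ⟶ V) (a' : Spec (.of Ω) ⟶ V')
  (hpt : y ≫ j = a ≫ z) (hpt'' : y'' ≫ j = a ≫ z'') (e : a' ≫ g = a)
  (js : Us ⟶ T) (ys ys'' : Spec (.of κ) ⟶ Us) (b : Spec (.of κ) ⟶ V) (b' : Spec (.of κ) ⟶ V')
  (hspt : ys ≫ js = b ≫ z) (hspt'' : ys'' ≫ js = b ≫ z'') (es : b' ≫ g = b)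
  (𝒜 𝒞 : AbelianSchemeOver T)
  (U : ((𝒜.baseChange z).baseChange g).X ⟶ ((𝒞.baseChange z'').baseChange g).X) [IsMonHom U]
  (u : ((𝒜.baseChange j).baseChange y).X ⟶ ((𝒞.baseChange j).baseChange y'').X) [IsMonHom u]
  [QuasiCompact a'] [IsSchemeTheoreticallyDominant a']
  (hfib : fibreHom U a' =
    (𝒜.fibreBaseChangeIso j y ≪≫ 𝒜.fibreCongrPtIso hpt ≪≫ (𝒜.fibreBaseChangeIso z a).symm ≪≫
        ((𝒜.baseChange z).fibreCongrPtIso e).symm ≪≫ ((𝒜.baseChange z).fibreBaseChangeIso g a').symm).inv ≫ homOfIsMonHom u ≫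
      (𝒞.fibreBaseChangeIso j y'' ≪≫ 𝒞.fibreCongrPtIso hpt'' ≪≫ (𝒞.fibreBaseChangeIso z'' a).symm ≪≫
        ((𝒞.baseChange z'').fibreCongrPtIso e).symm ≪≫ ((𝒞.baseChange z'').fibreBaseChangeIso g a').symm).hom)

include hfib in
set_option maxHeartbeats 400000 in
/-- **THE ONE-SIDED KERNEL BOUND TRANSFERS FROM THE GENERIC TO THE SPECIAL FIBRE.**  Abstract two-stage setting of ★ (ν8) §1 (`U` a stage homomorphism whose `a′`-fibre
is `u` through the generic five-piece isomorphisms, `hfib`), plus an `𝒪`-action `act` on `𝒜`, ANY ideal `𝔞` of `𝒪`, and `Ker U` FLAT over the stage.  If `Ker u ⊆ 𝒜_y[𝔞]`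
on all `T`-points, then `ū := E_𝒜 ≫ U_{b′} ≫ E_𝒞⁻¹` has `Ker ū ⊆ 𝒜_{ys}[𝔞]` on all `T`-points: transport to `U_{a′}` (§0, ★ (ν6) §1 naturality at `ι(r)`), §1 stage lemma,
transport back through the special five-piece isomorphisms. [cite: BoschLutkebohmertRaynaud1990, §7.3 Prop. 6 (p. 180)] [cite: SerreTate1968, §1 Lemma 2]
[cite: MumfordFogartyKirwan1994, Ch. 6 §1 Corollary 6.2 (p. 116)] [cite: EGAIV3, 11.10.5] -/
theorem comp_specialFibre_i_eq_one_of_generic {O : Type*} [CommRing O] (act : 𝒜.RingAction O) (𝔞 : Ideal O) [Flat (ker U).hom]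
    (hker : ∀ ⦃W : Over (Spec (.of Ω))⦄ (t : W ⟶ ((𝒜.baseChange j).baseChange y).X),
      t ≫ u = 1 → ∀ r ∈ 𝔞, t ≫ ((act.baseChange j).baseChange y).i r = 1)
    ⦃W : Over (Spec (.of κ))⦄ (t : W ⟶ ((𝒜.baseChange js).baseChange ys).X) :
    t ≫ ((𝒜.fibreBaseChangeIso js ys ≪≫ 𝒜.fibreCongrPtIso hspt ≪≫ (𝒜.fibreBaseChangeIso z b).symm ≪≫
              ((𝒜.baseChange z).fibreCongrPtIso es).symm ≪≫ ((𝒜.baseChange z).fibreBaseChangeIso g b').symm).hom ≫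
            fibreHom U b' ≫
          (𝒞.fibreBaseChangeIso js ys'' ≪≫ 𝒞.fibreCongrPtIso hspt'' ≪≫ (𝒞.fibreBaseChangeIso z'' b).symm ≪≫
              ((𝒞.baseChange z'').fibreCongrPtIso es).symm ≪≫ ((𝒞.baseChange z'').fibreBaseChangeIso g b').symm).inv).hom.hom.hom = 1 →
      ∀ r ∈ 𝔞, t ≫ ((act.baseChange js).baseChange ys).i r = 1 := by
  haveI : ∀ r, IsMonHom (act.i r) := act.isMonHom
  haveI : ∀ r, IsMonHom (baseChangeHom (act.i r) j) := fun r => (act.baseChange j).isMonHom r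
  haveI : ∀ r, IsMonHom (baseChangeHom (baseChangeHom (act.i r) j) y) := fun r => ((act.baseChange j).baseChange y).isMonHom r
  haveI : ∀ r, IsMonHom (baseChangeHom (act.i r) z) := fun r => (act.baseChange z).isMonHom r
  haveI : ∀ r, IsMonHom (baseChangeHom (baseChangeHom (act.i r) z) g) := fun r => ((act.baseChange z).baseChange g).isMonHom r
  haveI : ∀ r, IsMonHom (baseChangeHom (act.i r) js) := fun r => (act.baseChange js).isMonHom r
  haveI : ∀ r, IsMonHom (baseChangeHom (baseChangeHom (act.i r) js) ys) := fun r => ((act.baseChange js).baseChange ys).isMonHom r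
  -- Step A: the bound for `U_{a′}` — transport of `hker` through the generic five-piece isomorphisms (`hfib`; naturality ★ (ν6) §1)
  have hgen : ∀ ⦃W : Over (Spec (.of Ω))⦄ (t : W ⟶ (((𝒜.baseChange z).baseChange g).baseChange a').X),
      t ≫ baseChangeHom U a' = 1 → ∀ r ∈ 𝔞, t ≫ (((act.baseChange z).baseChange g).baseChange a').i r = 1 := fun W t =>
    comp_eq_one_of_conj_of_kerBound _ _ hfib (𝔞 : Set O) (fun r => fibreHom (baseChangeHom (act.i r) j) y)
      (fun r => fibreHom (baseChangeHom (baseChangeHom (act.i r) z) g) a')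
      (fun r _ => fibreHom_comp_alongStageIso_hom j z g y a a' hpt e 𝒜 𝒜 (act.i r)) hker t
  -- Step B: the bound for `U_{b′}` (§1: `ι(r)` kills the flat `Ker U`, decided at `a′`; kernels commute with base change)
  have hsp : ∀ ⦃W : Over (Spec (.of κ))⦄ (t : W ⟶ (((𝒜.baseChange z).baseChange g).baseChange b').X),
      t ≫ baseChangeHom U b' = 1 → ∀ r ∈ 𝔞, t ≫ (((act.baseChange z).baseChange g).baseChange b').i r = 1 :=
    comp_i_eq_one_special_of_generic a' b' ((act.baseChange z).baseChange g) U 𝔞 hgen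
  -- Step C: transport back through the special five-piece isomorphisms (naturality ★ (ν6) §1)
  exact comp_eq_one_of_conj_of_kerBound' _ _ (fibreHom U b') (𝔞 : Set O) (fun r => fibreHom (baseChangeHom (baseChangeHom (act.i r) z) g) b')
    (fun r => fibreHom (baseChangeHom (act.i r) js) ys) (fun r _ => fibreHom_comp_alongStageIso_hom js z g ys b b' hspt es 𝒜 𝒜 (act.i r)) hsp t

end AbstractKerBound

section HeadKB

/-! ### §3 The head: ★ (ν8h) verbatim, with the sixth transfer (v-b) -/

variable {K : Type} [Field K] [NumberField K] {v : HeightOneSpectrum (𝓞 K)} {Y : SchemeOver K}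
  (𝓨 : IntegralModel (valuationSubringAtPrime K v) K Y) [IsProper 𝓨.total.hom]
  (𝒜 𝒞 : AbelianSchemeOver 𝓨.total.left) (x x'' : AlgPoints Y (AlgebraicClosure (v.adicCompletion K)))

set_option maxHeartbeats 800000 in -- = ★ (ν8h) p849598's budget for the same head (the turnkey `obtain` of 40 components dominates; 400 000 times out at `whnf`); (v-b) is one more `exact`
/-- **THE SPECIAL FIBRE OF THE REDUCTION OF A HOMOMORPHISM BETWEEN FIBRE TUPLES, WITH ITS FOUR TRANSFERS, THE POST-COMPOSITION TRANSFER AND THE ONE-SIDED KERNEL BOUND.**  ★ (ν8h)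
`exists_specialFibre_hom_reduction_comp` verbatim, i.e.  ★ (ν8)
`exists_specialFibre_hom_reduction` verbatim — `𝓨` a proper model at `v`, `𝒜, 𝒞 → 𝓨` abelian schemes, `x, x″ ∈ Y(Ω)`, `u : (𝒜_η)_x → (𝒞_η)_{x″}` a homomorphism; output
`ū : (𝒜_s)_{x̄} → (𝒞_s)_{x̄″}` with (i) finite surjective ⇒ flat surjective, (ii) equivariance, (iii) section values, (iv) polarisation laws — PLUS **(iv-h)**: for every
`ℰ → 𝓨`, every homomorphism `h : 𝒞 → ℰ` over `𝓨`, every homomorphism `u₂` with `u₂ = u ≫ h_{x″}` (iterated base change of `h` along `ι_η` then `x″`), dual pairs and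
polarisations `(D_𝒜, λ_𝒜)`, `(D_ℰ, λ_ℰ)` and `n` with `u₂ ≫ (λ_ℰ)_{x″} ≫ u₂^∨ = (λ_𝒜)_x ≫ [n]`, and every homomorphism `w` with `w = ū ≫ h_{x̄″}` (iterated base change of `h`
along `ι_s` then `x̄″`): `w ≫ (λ_ℰ)_{x̄″} ≫ w^∨ = (λ_𝒜)_{x̄} ≫ [n]`.  (`u₂`, `w` are quantified with their defining equations so that no instance on a composite is needed at
the consumer.)  PLUS, for an `𝒪`-action `act` on `𝒜` (a binder of the head), **(v-b)**: if `u` is finite surjective then for EVERY ideal `𝔞` of `𝒪`, `Ker u ⊆ 𝒜_x[𝔞]` on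
all `T`-points (`t ≫ u = 1 → ∀ r ∈ 𝔞, t ≫ ι(r)_x = 1`, currency `((act.baseChange _).baseChange x.left).i r` of ★ (ν8k)) implies `Ker ū ⊆ 𝒜_{x̄}[𝔞]` on all `T`-points —
`Ker U → Spec D′` is flat (every fibre of `U` an isogeny, ★ `flat_ker_hom`) and §2. [cite: SerreTate1968, §1 Lemma 2] [cite: BoschLutkebohmertRaynaud1990, §1.2 Prop. 8 and §7.3 Prop. 6 (p. 180)]
[cite: MumfordFogartyKirwan1994, Ch. 6 §1 Corollary 6.2 (p. 116); Ch. 7 §2 Definition 7.2 (p. 129)] [cite: MumfordAV1970, §15 Thm. 1 (p. 143)] -/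
theorem exists_specialFibre_hom_reduction_comp_kerBound
    (u : ((𝒜.baseChange (𝓨.genericIso'.inv.left ≫ pullback.fst 𝓨.total.hom (specGenericPoint (valuationSubringAtPrime K v) K))).baseChange x.left).X ⟶
         ((𝒞.baseChange (𝓨.genericIso'.inv.left ≫ pullback.fst 𝓨.total.hom (specGenericPoint (valuationSubringAtPrime K v) K))).baseChange x''.left).X)
    [IsMonHom u]
    -- (ν8k-b) extra datum: an `𝒪`-action on `𝒜` (no Serre presentation is asked)
    {O : Type} [CommRing O] (act : 𝒜.RingAction O) :
    ∃ (ubar : ((𝒜.baseChange (pullback.fst 𝓨.total.hom (specResidueField v))).baseChange (𝓨.geomReductionMap x).left).X ⟶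
               ((𝒞.baseChange (pullback.fst 𝓨.total.hom (specResidueField v))).baseChange (𝓨.geomReductionMap x'').left).X) (_ : IsMonHom ubar),
      -- (i) finite surjective ⇒ flat surjective
      (IsFinite u.left → Surjective u.left → Flat ubar.left ∧ Function.Surjective ubar.left.base) ∧
      -- (ii) equivariance for endomorphism pairs transfers
      (∀ (f : 𝒜.X ⟶ 𝒜.X) (g : 𝒞.X ⟶ 𝒞.X) [IsMonHom f] [IsMonHom g],
        baseChangeHom (baseChangeHom f _) x.left ≫ u = u ≫ baseChangeHom (baseChangeHom g _) x''.left →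
        baseChangeHom (baseChangeHom f (pullback.fst 𝓨.total.hom (specResidueField v))) (𝓨.geomReductionMap x).left ≫ ubar =
          ubar ≫ baseChangeHom (baseChangeHom g (pullback.fst 𝓨.total.hom (specResidueField v))) (𝓨.geomReductionMap x'').left) ∧
      -- (iii) identities of section values transfer
      (∀ (τ : 𝒜.Sections) (τ'' : 𝒞.Sections),
        AlgPoints.map u ((𝒜.baseChange _).restrictPt x.left (𝒜.sectionBaseChange _ τ)) =
          (𝒞.baseChange _).restrictPt x''.left (𝒞.sectionBaseChange _ τ'') →
        AlgPoints.map ubar ((𝒜.baseChange (pullback.fst 𝓨.total.hom (specResidueField v))).restrictPt (𝓨.geomReductionMap x).left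
            (𝒜.sectionBaseChange _ τ)) =
          (𝒞.baseChange (pullback.fst 𝓨.total.hom (specResidueField v))).restrictPt (𝓨.geomReductionMap x'').left (𝒞.sectionBaseChange _ τ'')) ∧
      -- (iv) a polarisation law in dual-homomorphism form transfers
      (∀ (D𝒜 : 𝒜.DualPair) (pol𝒜 : 𝒜.Polarization D𝒜) (D𝒞 : 𝒞.DualPair) (pol𝒞 : 𝒞.Polarization D𝒞) (n : ℕ),
        u ≫ ((pol𝒞.baseChange _).baseChange x''.left).lam ≫ DualPair.dualIsogenyOver u ((D𝒜.baseChange _).baseChange x.left) ((D𝒞.baseChange _).baseChange x''.left) =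
          ((pol𝒜.baseChange _).baseChange x.left).lam ≫ ((D𝒜.baseChange _).baseChange x.left).hat.mulN n →
        ubar ≫ ((pol𝒞.baseChange (pullback.fst 𝓨.total.hom (specResidueField v))).baseChange (𝓨.geomReductionMap x'').left).lam ≫
            DualPair.dualIsogenyOver ubar ((D𝒜.baseChange (pullback.fst 𝓨.total.hom (specResidueField v))).baseChange (𝓨.geomReductionMap x).left)
              ((D𝒞.baseChange (pullback.fst 𝓨.total.hom (specResidueField v))).baseChange (𝓨.geomReductionMap x'').left) =
          ((pol𝒜.baseChange (pullback.fst 𝓨.total.hom (specResidueField v))).baseChange (𝓨.geomReductionMap x).left).lam ≫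
            ((D𝒜.baseChange (pullback.fst 𝓨.total.hom (specResidueField v))).baseChange (𝓨.geomReductionMap x).left).hat.mulN n) ∧
      -- (iv-h) the polarisation law of a POST-COMPOSITE `u ≫ h_{x″}` with a MODEL homomorphism `h : 𝒞 → ℰ` transfers to `ū ≫ h_{x̄″}` (this file)
      (∀ (ℰ : AbelianSchemeOver 𝓨.total.left) (h : 𝒞.X ⟶ ℰ.X) [IsMonHom h]
        (u₂ : ((𝒜.baseChange (𝓨.genericIso'.inv.left ≫ pullback.fst 𝓨.total.hom (specGenericPoint (valuationSubringAtPrime K v) K))).baseChange x.left).X ⟶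
          ((ℰ.baseChange (𝓨.genericIso'.inv.left ≫ pullback.fst 𝓨.total.hom (specGenericPoint (valuationSubringAtPrime K v) K))).baseChange x''.left).X) [IsMonHom u₂],
        u₂ = u ≫ baseChangeHom (baseChangeHom h (𝓨.genericIso'.inv.left ≫ pullback.fst 𝓨.total.hom (specGenericPoint (valuationSubringAtPrime K v) K))) x''.left →
        ∀ (D𝒜 : 𝒜.DualPair) (pol𝒜 : 𝒜.Polarization D𝒜) (Dℰ : ℰ.DualPair) (polℰ : ℰ.Polarization Dℰ) (n : ℕ),
        u₂ ≫ ((polℰ.baseChange (𝓨.genericIso'.inv.left ≫ pullback.fst 𝓨.total.hom (specGenericPoint (valuationSubringAtPrime K v) K))).baseChange x''.left).lam ≫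
            DualPair.dualIsogenyOver u₂ ((D𝒜.baseChange (𝓨.genericIso'.inv.left ≫ pullback.fst 𝓨.total.hom (specGenericPoint (valuationSubringAtPrime K v) K))).baseChange x.left) ((Dℰ.baseChange (𝓨.genericIso'.inv.left ≫ pullback.fst 𝓨.total.hom (specGenericPoint (valuationSubringAtPrime K v) K))).baseChange x''.left) =
          ((pol𝒜.baseChange (𝓨.genericIso'.inv.left ≫ pullback.fst 𝓨.total.hom (specGenericPoint (valuationSubringAtPrime K v) K))).baseChange x.left).lam ≫ ((D𝒜.baseChange (𝓨.genericIso'.inv.left ≫ pullback.fst 𝓨.total.hom (specGenericPoint (valuationSubringAtPrime K v) K))).baseChange x.left).hat.mulN n →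
        ∀ (w : ((𝒜.baseChange (pullback.fst 𝓨.total.hom (specResidueField v))).baseChange (𝓨.geomReductionMap x).left).X ⟶
          ((ℰ.baseChange (pullback.fst 𝓨.total.hom (specResidueField v))).baseChange (𝓨.geomReductionMap x'').left).X) [IsMonHom w],
        w = ubar ≫ baseChangeHom (baseChangeHom h (pullback.fst 𝓨.total.hom (specResidueField v))) (𝓨.geomReductionMap x'').left →
        w ≫ ((polℰ.baseChange (pullback.fst 𝓨.total.hom (specResidueField v))).baseChange (𝓨.geomReductionMap x'').left).lam ≫
            DualPair.dualIsogenyOver w ((D𝒜.baseChange (pullback.fst 𝓨.total.hom (specResidueField v))).baseChange (𝓨.geomReductionMap x).left) ((Dℰ.baseChange (pullback.fst 𝓨.total.hom (specResidueField v))).baseChange (𝓨.geomReductionMap x'').left) =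
          ((pol𝒜.baseChange (pullback.fst 𝓨.total.hom (specResidueField v))).baseChange (𝓨.geomReductionMap x).left).lam ≫
            ((D𝒜.baseChange (pullback.fst 𝓨.total.hom (specResidueField v))).baseChange (𝓨.geomReductionMap x).left).hat.mulN n) ∧
      -- (v-b) a ONE-SIDED kernel bound `Ker u ⊆ 𝒜_x[𝔞]` on all `T`-points transfers to `Ker ū ⊆ 𝒜_{x̄}[𝔞]` on ALL `T`-points, for every ideal `𝔞` (this file)
      (IsFinite u.left → Surjective u.left → ∀ 𝔞 : Ideal O,
        (∀ ⦃T : Over (Spec (.of (AlgebraicClosure (v.adicCompletion K))))⦄ (t : T ⟶ ((𝒜.baseChange (𝓨.genericIso'.inv.left ≫ pullback.fst 𝓨.total.hom (specGenericPoint (valuationSubringAtPrime K v) K))).baseChange x.left).X),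
          t ≫ u = 1 → ∀ r ∈ 𝔞, t ≫ ((act.baseChange (𝓨.genericIso'.inv.left ≫ pullback.fst 𝓨.total.hom (specGenericPoint (valuationSubringAtPrime K v) K))).baseChange x.left).i r = 1) →
        ∀ ⦃T : Over (Spec (.of (geomResidueField v)))⦄ (t : T ⟶ ((𝒜.baseChange (pullback.fst 𝓨.total.hom (specResidueField v))).baseChange (𝓨.geomReductionMap x).left).X),
          t ≫ ubar = 1 → ∀ r ∈ 𝔞, t ≫ ((act.baseChange (pullback.fst 𝓨.total.hom (specResidueField v))).baseChange (𝓨.geomReductionMap x).left).i r = 1) := by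
  -- the homomorphism of abelian varieties underlying `u`, and the TURNKEY reduction ★ (ν7)
  obtain ⟨D, _i1, _i2, L, _i3, _i4, _i5, _i6, _i7, _i8, gD, h, hh, hgD, ha, z, z'', hz, hz'', L', _j1, _j2, _j3, _j4, _j5, χ, h', U, hU,
      hpt, hpt'', e, hspt, hspt'', et, hχ, hh', hh'h, hDed, hFrac, hfib, huniq, hisog⟩ :=
    exists_stage_hom_reduction_turnkey 𝓨 𝒜 𝒞 x x'' (homOfIsMonHom u)
  haveI := hDed
  haveI := hFrac
  haveI := hU
  -- injectivity of restriction to the `Ω`-point `ξ′` of the refined stage (schematically dominant: `D′ → Ω` injective)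
  have h'inj : Function.Injective h' := by
    intro a b hab
    have h1 : χ (a : L') = χ (b : L') := by rw [← hh', ← hh', hab]
    exact Subtype.ext (hχ h1)
  haveI : IsDominant (specGenericPoint (closureValuationSubring (v.adicCompletion K)) (AlgebraicClosure (v.adicCompletion K)) ≫ Spec.map (CommRingCat.ofHom h')) := by
    haveI := isDominant_specMap_of_injective
      (algebraMap (closureValuationSubring (v.adicCompletion K)) (AlgebraicClosure (v.adicCompletion K))) Subtype.val_injective
    haveI := isDominant_specMap_of_injective h' h'inj
    infer_instance
  haveI : IsSchemeTheoreticallyDominant (specGenericPoint (closureValuationSubring (v.adicCompletion K)) (AlgebraicClosure (v.adicCompletion K)) ≫ Spec.map (CommRingCat.ofHom h')) := IsSchemeTheoreticallyDominant.of_isDominant _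
  -- the special fibre of `U`, transported along the special five-piece along-stage isomorphisms (★ (ν6) §1 shape at `j := ι_s`, `y := x̄`, `a := cp ≫ Spec h`,
  -- `a′ := t′ := cp ≫ Spec h′`, `hpt := hspt`, `e := et`; `cp : Spec κ̄ → Spec R` the geometric closed point of `R`): `ū := E_𝒜 ≫ U_{t′} ≫ E_𝒞⁻¹`, written literally
  refine ⟨((𝒜.fibreBaseChangeIso (pullback.fst 𝓨.total.hom (specResidueField v)) (𝓨.geomReductionMap x).left ≪≫ 𝒜.fibreCongrPtIso hspt ≪≫ (𝒜.fibreBaseChangeIso z.left (((geomClosedPointIsoSpecResidueField v).inv.left ≫ (specRingHomι (closureValuationSubring (v.adicCompletion K)) (toClosureValuationSubring v) (IsLocalRing.residue (closureValuationSubring (v.adicCompletion K)))).left) ≫ Spec.map (CommRingCat.ofHom h))).symm ≪≫ ((𝒜.baseChange z.left).fibreCongrPtIso et).symm ≪≫ ((𝒜.baseChange z.left).fibreBaseChangeIso (Spec.map (CommRingCat.ofHom (algebraMap D (integralClosure D L')))) (((geomClosedPointIsoSpecResidueField v).inv.left ≫ (specRingHomι (closureValuationSubring (v.adicCompletion K))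 (toClosureValuationSubring v) (IsLocalRing.residue (closureValuationSubring (v.adicCompletion K)))).left) ≫ Spec.map (CommRingCat.ofHom h'))).symm).hom ≫ fibreHom U (((geomClosedPointIsoSpecResidueField v).inv.left ≫ (specRingHomι (closureValuationSubring (v.adicCompletion K)) (toClosureValuationSubring v) (IsLocalRing.residue (closureValuationSubring (v.adicCompletion K)))).left) ≫ Spec.map (CommRingCat.ofHom h')) ≫ (𝒞.fibreBaseChangeIso (pullback.fst 𝓨.total.hom (specResidueField v)) (𝓨.geomReductionMap x'').left ≪≫ 𝒞.fibreCongrPtIso hspt'' ≪≫ (𝒞.fibreBaseChangeIso z''.left (((geomClosedPointIsoSpecResidueField v).inv.left ≫ (specRingHomι (closureValuationSubring (v.adicCompletion K)) (toClosureValuationSubring v) (IsLocalRing.residue (closureValuationSubring (v.adicCompletion K)))).left) ≫ Spec.map (CommRingCat.ofHom h))).symm ≪≫ ((𝒞.baseChange z''.left).fibreCongrPtIso et).symm ≪≫ ((𝒞.baseChange z''.left).fibreBaseChangeIso (Spec.map (CommRingCat.ofHom (algebraMap D (integralClosure D L')))) (((geomClosedPointIsoSpecResidueField v).inv.left ≫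 (specRingHomι (closureValuationSubring (v.adicCompletion K)) (toClosureValuationSubring v) (IsLocalRing.residue (closureValuationSubring (v.adicCompletion K)))).left) ≫ Spec.map (CommRingCat.ofHom h'))).symm).inv).hom.hom.hom,
    ((𝒜.fibreBaseChangeIso (pullback.fst 𝓨.total.hom (specResidueField v)) (𝓨.geomReductionMap x).left ≪≫ 𝒜.fibreCongrPtIso hspt ≪≫ (𝒜.fibreBaseChangeIso z.left (((geomClosedPointIsoSpecResidueField v).inv.left ≫ (specRingHomι (closureValuationSubring (v.adicCompletion K)) (toClosureValuationSubring v) (IsLocalRing.residue (closureValuationSubring (v.adicCompletion K)))).left) ≫ Spec.map (CommRingCat.ofHom h))).symm ≪≫ ((𝒜.baseChange z.left).fibreCongrPtIso et).symm ≪≫ ((𝒜.baseChange z.left).fibreBaseChangeIso (Spec.map (CommRingCat.ofHom (algebraMap D (integralClosure D L')))) (((geomClosedPointIsoSpecResidueField v).inv.left ≫ (specRingHomι (closureValuationSubring (v.adicCompletion K)) (toClosureValuationSubring v) (IsLocalRing.residue (closureValuationSubring (v.adicCompletion K)))).left) ≫ Spec.map (CommRingCat.ofHom h'))).symm).hom ≫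 fibreHom U (((geomClosedPointIsoSpecResidueField v).inv.left ≫ (specRingHomι (closureValuationSubring (v.adicCompletion K)) (toClosureValuationSubring v) (IsLocalRing.residue (closureValuationSubring (v.adicCompletion K)))).left) ≫ Spec.map (CommRingCat.ofHom h')) ≫ (𝒞.fibreBaseChangeIso (pullback.fst 𝓨.total.hom (specResidueField v)) (𝓨.geomReductionMap x'').left ≪≫ 𝒞.fibreCongrPtIso hspt'' ≪≫ (𝒞.fibreBaseChangeIso z''.left (((geomClosedPointIsoSpecResidueField v).inv.left ≫ (specRingHomι (closureValuationSubring (v.adicCompletion K)) (toClosureValuationSubring v) (IsLocalRing.residue (closureValuationSubring (v.adicCompletion K)))).left) ≫ Spec.map (CommRingCat.ofHom h))).symm ≪≫ ((𝒞.baseChange z''.left).fibreCongrPtIso et).symm ≪≫ ((𝒞.baseChange z''.left).fibreBaseChangeIso (Spec.map (CommRingCat.ofHom (algebraMap D (integralClosure D L')))) (((geomClosedPointIsoSpecResidueField v).inv.left ≫ (specRingHomι (closureValuationSubring (v.adicCompletion K)) (toClosureValuationSubring v) (IsLocalRing.residue (closureValuationSubring (v.adicCompletion K)))).left) ≫ Spec.map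 (CommRingCat.ofHom h'))).symm).inv).hom.hom.isMonHom_hom, ?_, ?_, ?_, ?_, ?_, ?_⟩
  · -- (i) finite surjective ⇒ flat surjective: `u` is an isogeny ⇒ (★ (ν7)) `U_{t′}` is ⇒ `ū` is (★ `isIsogeny_hom_comp_iso`) ⇒ flat (★ `IsIsogeny.flat`)
    intro hfin hsurj
    have hu : AbelianVariety.IsIsogeny (homOfIsMonHom u) := ⟨hsurj, hfin⟩
    have hub : AbelianVariety.IsIsogeny ((𝒜.fibreBaseChangeIso (pullback.fst 𝓨.total.hom (specResidueField v)) (𝓨.geomReductionMap x).left ≪≫ 𝒜.fibreCongrPtIso hspt ≪≫ (𝒜.fibreBaseChangeIso z.left (((geomClosedPointIsoSpecResidueField v).inv.left ≫ (specRingHomι (closureValuationSubring (v.adicCompletion K)) (toClosureValuationSubring v) (IsLocalRing.residue (closureValuationSubring (v.adicCompletion K)))).left) ≫ Spec.map (CommRingCat.ofHom h))).symm ≪≫ ((𝒜.baseChange z.left).fibreCongrPtIso et).symm ≪≫ ((𝒜.baseChange z.left).fibreBaseChangeIso (Spec.map (CommRingCat.ofHom (algebraMap D (integralClosure D L'))))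 (((geomClosedPointIsoSpecResidueField v).inv.left ≫ (specRingHomι (closureValuationSubring (v.adicCompletion K)) (toClosureValuationSubring v) (IsLocalRing.residue (closureValuationSubring (v.adicCompletion K)))).left) ≫ Spec.map (CommRingCat.ofHom h'))).symm).hom ≫ fibreHom U (((geomClosedPointIsoSpecResidueField v).inv.left ≫ (specRingHomι (closureValuationSubring (v.adicCompletion K)) (toClosureValuationSubring v) (IsLocalRing.residue (closureValuationSubring (v.adicCompletion K)))).left) ≫ Spec.map (CommRingCat.ofHom h')) ≫ (𝒞.fibreBaseChangeIso (pullback.fst 𝓨.total.hom (specResidueField v)) (𝓨.geomReductionMap x'').left ≪≫ 𝒞.fibreCongrPtIso hspt'' ≪≫ (𝒞.fibreBaseChangeIso z''.left (((geomClosedPointIsoSpecResidueField v).inv.left ≫ (specRingHomι (closureValuationSubring (v.adicCompletion K)) (toClosureValuationSubring v) (IsLocalRing.residue (closureValuationSubring (v.adicCompletion K)))).left) ≫ Spec.map (CommRingCat.ofHom h))).symm ≪≫ ((𝒞.baseChange z''.left).fibreCongrPtIso et).symm ≪≫ ((𝒞.baseChange z''.left).fibreBaseChangeIso (Spec.map (CommRingCat.ofHom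 (algebraMap D (integralClosure D L')))) (((geomClosedPointIsoSpecResidueField v).inv.left ≫ (specRingHomι (closureValuationSubring (v.adicCompletion K)) (toClosureValuationSubring v) (IsLocalRing.residue (closureValuationSubring (v.adicCompletion K)))).left) ≫ Spec.map (CommRingCat.ofHom h'))).symm).inv) :=
      isIsogeny_hom_comp_iso (𝒜.fibreBaseChangeIso (pullback.fst 𝓨.total.hom (specResidueField v)) (𝓨.geomReductionMap x).left ≪≫ 𝒜.fibreCongrPtIso hspt ≪≫ (𝒜.fibreBaseChangeIso z.left (((geomClosedPointIsoSpecResidueField v).inv.left ≫ (specRingHomι (closureValuationSubring (v.adicCompletion K)) (toClosureValuationSubring v) (IsLocalRing.residue (closureValuationSubring (v.adicCompletion K)))).left) ≫ Spec.map (CommRingCat.ofHom h))).symm ≪≫ ((𝒜.baseChange z.left).fibreCongrPtIso et).symm ≪≫ ((𝒜.baseChange z.left).fibreBaseChangeIso (Spec.map (CommRingCat.ofHom (algebraMap D (integralClosure D L')))) (((geomClosedPointIsoSpecResidueField v).inv.left ≫ (specRingHomι (closureValuationSubring (v.adicCompletion K)) (toClosureValuationSubring v) (IsLocalRing.residue (closureValuationSubring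 (v.adicCompletion K)))).left) ≫ Spec.map (CommRingCat.ofHom h'))).symm) (fibreHom U (((geomClosedPointIsoSpecResidueField v).inv.left ≫ (specRingHomι (closureValuationSubring (v.adicCompletion K)) (toClosureValuationSubring v) (IsLocalRing.residue (closureValuationSubring (v.adicCompletion K)))).left) ≫ Spec.map (CommRingCat.ofHom h'))) (𝒞.fibreBaseChangeIso (pullback.fst 𝓨.total.hom (specResidueField v)) (𝓨.geomReductionMap x'').left ≪≫ 𝒞.fibreCongrPtIso hspt'' ≪≫ (𝒞.fibreBaseChangeIso z''.left (((geomClosedPointIsoSpecResidueField v).inv.left ≫ (specRingHomι (closureValuationSubring (v.adicCompletion K)) (toClosureValuationSubring v) (IsLocalRing.residue (closureValuationSubring (v.adicCompletion K)))).left) ≫ Spec.map (CommRingCat.ofHom h))).symm ≪≫ ((𝒞.baseChange z''.left).fibreCongrPtIso et).symm ≪≫ ((𝒞.baseChange z''.left).fibreBaseChangeIso (Spec.map (CommRingCat.ofHom (algebraMap D (integralClosure D L')))) (((geomClosedPointIsoSpecResidueField v).inv.left ≫ (specRingHomι (closureValuationSubring (v.adicCompletion K)) (toClosureValuationSubring v)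 (IsLocalRing.residue (closureValuationSubring (v.adicCompletion K)))).left) ≫ Spec.map (CommRingCat.ofHom h'))).symm).symm (hisog hu (((geomClosedPointIsoSpecResidueField v).inv.left ≫ (specRingHomι (closureValuationSubring (v.adicCompletion K)) (toClosureValuationSubring v) (IsLocalRing.residue (closureValuationSubring (v.adicCompletion K)))).left) ≫ Spec.map (CommRingCat.ofHom h')))
    exact ⟨hub.flat, hub.1.surj⟩
  · -- (ii) equivariance transfers (§1 `baseChangeHom_comp_specialFibre_eq_of_generic` at the turnkey's two stages)
    intro f g hf hg hfg
    exact baseChangeHom_comp_specialFibre_eq_of_generic (𝓨.genericIso'.inv.left ≫ pullback.fst 𝓨.total.hom (specGenericPoint (valuationSubringAtPrime K v) K)) z.left z''.left (Spec.map (CommRingCat.ofHom (algebraMap D (integralClosure D L')))) x.left x''.left (specGenericPoint (closureValuationSubring (v.adicCompletion K)) (AlgebraicClosure (v.adicCompletion K)) ≫ Spec.map (CommRingCat.ofHom h)) (specGenericPoint (closureValuationSubring (v.adicCompletion K)) (AlgebraicClosure (v.adicCompletion K)) ≫ Spec.map (CommRingCat.ofHom h')) hpt hpt'' e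
      (pullback.fst 𝓨.total.hom (specResidueField v)) (𝓨.geomReductionMap x).left (𝓨.geomReductionMap x'').left (((geomClosedPointIsoSpecResidueField v).inv.left ≫ (specRingHomι (closureValuationSubring (v.adicCompletion K)) (toClosureValuationSubring v) (IsLocalRing.residue (closureValuationSubring (v.adicCompletion K)))).left) ≫ Spec.map (CommRingCat.ofHom h)) (((geomClosedPointIsoSpecResidueField v).inv.left ≫ (specRingHomι (closureValuationSubring (v.adicCompletion K)) (toClosureValuationSubring v) (IsLocalRing.residue (closureValuationSubring (v.adicCompletion K)))).left) ≫ Spec.map (CommRingCat.ofHom h')) hspt hspt'' et 𝒜 𝒞 U u hfib f g hfg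
  · -- (iii) section values transfer (§1 `map_specialFibre_restrictPt_eq_of_generic`)
    intro τ τ'' hτ
    exact map_specialFibre_restrictPt_eq_of_generic (𝓨.genericIso'.inv.left ≫ pullback.fst 𝓨.total.hom (specGenericPoint (valuationSubringAtPrime K v) K)) z.left z''.left (Spec.map (CommRingCat.ofHom (algebraMap D (integralClosure D L')))) x.left x''.left (specGenericPoint (closureValuationSubring (v.adicCompletion K)) (AlgebraicClosure (v.adicCompletion K)) ≫ Spec.map (CommRingCat.ofHom h)) (specGenericPoint (closureValuationSubring (v.adicCompletion K)) (AlgebraicClosure (v.adicCompletion K)) ≫ Spec.map (CommRingCat.ofHom h')) hpt hpt'' e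
      (pullback.fst 𝓨.total.hom (specResidueField v)) (𝓨.geomReductionMap x).left (𝓨.geomReductionMap x'').left (((geomClosedPointIsoSpecResidueField v).inv.left ≫ (specRingHomι (closureValuationSubring (v.adicCompletion K)) (toClosureValuationSubring v) (IsLocalRing.residue (closureValuationSubring (v.adicCompletion K)))).left) ≫ Spec.map (CommRingCat.ofHom h)) (((geomClosedPointIsoSpecResidueField v).inv.left ≫ (specRingHomι (closureValuationSubring (v.adicCompletion K)) (toClosureValuationSubring v) (IsLocalRing.residue (closureValuationSubring (v.adicCompletion K)))).left) ≫ Spec.map (CommRingCat.ofHom h')) hspt hspt'' et 𝒜 𝒞 U u hfib τ τ'' hτ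
  · -- (iv) the polarisation law transfers (§1 `specialFibre_comp_lam_comp_dualIsogenyOver_eq_of_generic`; the refined stage `Spec D′` is connected, reduced, Noetherian)
    intro D𝒜 pol𝒜 D𝒞 pol𝒞 n hlam
    haveI : IsNoetherianRing (integralClosure D L') := inferInstance
    exact specialFibre_comp_lam_comp_dualIsogenyOver_eq_of_generic (𝓨.genericIso'.inv.left ≫ pullback.fst 𝓨.total.hom (specGenericPoint (valuationSubringAtPrime K v) K)) z.left z''.left (Spec.map (CommRingCat.ofHom (algebraMap D (integralClosure D L')))) x.left x''.left (specGenericPoint (closureValuationSubring (v.adicCompletion K)) (AlgebraicClosure (v.adicCompletion K)) ≫ Spec.map (CommRingCat.ofHom h)) (specGenericPoint (closureValuationSubring (v.adicCompletion K)) (AlgebraicClosure (v.adicCompletion K)) ≫ Spec.map (CommRingCat.ofHom h')) hpt hpt'' e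
      (pullback.fst 𝓨.total.hom (specResidueField v)) (𝓨.geomReductionMap x).left (𝓨.geomReductionMap x'').left (((geomClosedPointIsoSpecResidueField v).inv.left ≫ (specRingHomι (closureValuationSubring (v.adicCompletion K)) (toClosureValuationSubring v) (IsLocalRing.residue (closureValuationSubring (v.adicCompletion K)))).left) ≫ Spec.map (CommRingCat.ofHom h)) (((geomClosedPointIsoSpecResidueField v).inv.left ≫ (specRingHomι (closureValuationSubring (v.adicCompletion K)) (toClosureValuationSubring v) (IsLocalRing.residue (closureValuationSubring (v.adicCompletion K)))).left) ≫ Spec.map (CommRingCat.ofHom h')) hspt hspt'' et 𝒜 𝒞 U u hfib D𝒜 pol𝒜 D𝒞 pol𝒞 n hlam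
  · -- (iv-h) the post-composite (§1 `specialFibre_postcomp_comp_lam_comp_dualIsogenyOver_eq_of_generic`)
    intro ℰ hm _ u₂ _ hu₂eq D𝒜 pol𝒜 Dℰ polℰ n hlam w _ hweq
    haveI : IsNoetherianRing (integralClosure D L') := inferInstance
    exact specialFibre_postcomp_comp_lam_comp_dualIsogenyOver_eq_of_generic (𝓨.genericIso'.inv.left ≫ pullback.fst 𝓨.total.hom (specGenericPoint (valuationSubringAtPrime K v) K)) z.left z''.left (Spec.map (CommRingCat.ofHom (algebraMap D (integralClosure D L')))) x.left x''.left (specGenericPoint (closureValuationSubring (v.adicCompletion K)) (AlgebraicClosure (v.adicCompletion K)) ≫ Spec.map (CommRingCat.ofHom h)) (specGenericPoint (closureValuationSubring (v.adicCompletion K)) (AlgebraicClosure (v.adicCompletion K)) ≫ Spec.map (CommRingCat.ofHom h')) hpt hpt'' e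
      (pullback.fst 𝓨.total.hom (specResidueField v)) (𝓨.geomReductionMap x).left (𝓨.geomReductionMap x'').left (((geomClosedPointIsoSpecResidueField v).inv.left ≫ (specRingHomι (closureValuationSubring (v.adicCompletion K)) (toClosureValuationSubring v) (IsLocalRing.residue (closureValuationSubring (v.adicCompletion K)))).left) ≫ Spec.map (CommRingCat.ofHom h)) (((geomClosedPointIsoSpecResidueField v).inv.left ≫ (specRingHomι (closureValuationSubring (v.adicCompletion K)) (toClosureValuationSubring v) (IsLocalRing.residue (closureValuationSubring (v.adicCompletion K)))).left) ≫ Spec.map (CommRingCat.ofHom h')) hspt hspt'' et 𝒜 𝒞 U u hfib ℰ hm D𝒜 pol𝒜 Dℰ polℰ n u₂ hu₂eq hlam w hweq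
  · -- (v-b) the one-sided kernel bound (§2 `comp_specialFibre_i_eq_one_of_generic`; `Ker U → Spec D′` is flat: every fibre of `U` is an isogeny, ★ `flat_ker_hom`)
    intro hfin hsurj 𝔞 hle T t ht
    haveI : Flat (ker U).hom := flat_ker_hom L' U (hisog ⟨hsurj, hfin⟩ (specGenericPoint (integralClosure D L') L'))
    exact comp_specialFibre_i_eq_one_of_generic (𝓨.genericIso'.inv.left ≫ pullback.fst 𝓨.total.hom (specGenericPoint (valuationSubringAtPrime K v) K)) z.left z''.left (Spec.map (CommRingCat.ofHom (algebraMap D (integralClosure D L')))) x.left x''.left (specGenericPoint (closureValuationSubring (v.adicCompletion K)) (AlgebraicClosure (v.adicCompletion K)) ≫ Spec.map (CommRingCat.ofHom h)) (specGenericPoint (closureValuationSubring (v.adicCompletion K)) (AlgebraicClosure (v.adicCompletion K)) ≫ Spec.map (CommRingCat.ofHom h')) hpt hpt'' e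
      (pullback.fst 𝓨.total.hom (specResidueField v)) (𝓨.geomReductionMap x).left (𝓨.geomReductionMap x'').left (((geomClosedPointIsoSpecResidueField v).inv.left ≫ (specRingHomι (closureValuationSubring (v.adicCompletion K)) (toClosureValuationSubring v) (IsLocalRing.residue (closureValuationSubring (v.adicCompletion K)))).left) ≫ Spec.map (CommRingCat.ofHom h)) (((geomClosedPointIsoSpecResidueField v).inv.left ≫ (specRingHomι (closureValuationSubring (v.adicCompletion K)) (toClosureValuationSubring v) (IsLocalRing.residue (closureValuationSubring (v.adicCompletion K)))).left) ≫ Spec.map (CommRingCat.ofHom h')) hspt hspt'' et 𝒜 𝒞 U u hfib act 𝔞 hle t ht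

end HeadKB

end AbelianSchemeOver

end Literature.AlgebraicGeometry.AbelianSchemes

end
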